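import Literature.MathematicalPhysics.KineticTheory.HardSphereEulerProofs
import HarnessLib

/-!
# Rung-0 local statistics (stub S3b1 `stub_rung0LocalStatistics` of the line
# `preshock-kinetic-slaving`, crux `JParityClosure.EvenStressEnskog`, stmt-AtomisticToContinuum-13079)
# — helper file 1: three measure-free / model-free lemmas

* `integral_sq_sum_mul_pi` (with `memLp_sum_mul_pi`): for a probability measure `γ`, a centred
  `Y ∈ L²(γ)` and real weights `bᵢ`, `∫ (Σᵢ bᵢ Y(vᵢ))² dγ^{⊗n} = (Σᵢ bᵢ²) ∫ Y² dγ`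
  (independence of the coordinates of a product measure: `variance_sum_pi`).
* `tendsto_measure_le_abs_of_lintegral_sq`: `∫⁻ Z_N² dP_N → 0` implies `P_N {κ ≤ |Z_N|} → 0`
  (Markov's inequality in `∫⁻` form).
* `exists_forall_windowFields_lt`: the deterministic continuity estimate by which the
  convergence in probability `(ρ_r, m_r − ρ_r u, e_r − ρ_r c) → (1, 0, 0)`, `c = ‖u‖²/2 + 3θ/2`,
  transports to `|ρ_r − 1| + ‖ρ_r⁻¹ m_r − u‖ + |θ_r − θ| < ι`,
  `θ_r = (2/3)(e_r/ρ_r − ‖m_r‖²/(2ρ_r²))` (continuity at `(1, 0, 0)` of an explicit function).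
* `memLp_two_gaussMeasure_of_abs_le`, `integral_half_norm_sq_gaussMeasure`: a continuous `G` with
  `|G v| ≤ C(1 + ‖v‖²)` is in `L²(N(u, θ id))` (Gaussian fourth moments), and
  `∫ ‖v‖²/2 dN(u, θ id) = ‖u‖²/2 + 3θ/2`.

References: standard (Bienaymé, Markov); H. Spohn, *Large Scale Dynamics of Interacting Particles*
(1991), Part I §2.3 for the setting.
-/

noncomputable section

open MeasureTheory ProbabilityTheory Filter Set Topology
open scoped ENNReal InnerProductSpace BigOperators

namespace Summit.AtomisticToContinuum.HydrodynamicLimit.Theorems.EvenStressEnskog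

open Literature.Analysis.FluidPDE Literature.MathematicalPhysics.KineticTheory

/-! ## Weighted sums of independent centred variables -/

/-- A weighted sum `v ↦ Σᵢ bᵢ Y(vᵢ)` of `L²` coordinates is in `L²` of the product measure.
[folklore] -/
theorem memLp_sum_mul_pi {V : Type*} [MeasurableSpace V] (γ : Measure V) [IsProbabilityMeasure γ]
    {Y : V → ℝ} (hY : MemLp Y 2 γ) {n : ℕ} (b : Fin n → ℝ) :
    MemLp (fun v : Fin n → V => ∑ i, b i * Y (v i)) 2 (Measure.pi fun _ : Fin n => γ) :=
  memLp_finsetSum _ fun i _ =>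
    (hY.const_mul (b i)).comp_measurePreserving (measurePreserving_eval (fun _ : Fin n => γ) i)

/-- **Bienaymé for a weighted sum of i.i.d. centred variables**: for a probability measure `γ`,
`Y ∈ L²(γ)` with `∫ Y dγ = 0` and real weights `bᵢ`,
`∫ (Σᵢ bᵢ Y(vᵢ))² dγ^{⊗n} = (Σᵢ bᵢ²) · ∫ Y² dγ`. [folklore] -/
theorem integral_sq_sum_mul_pi {V : Type*} [MeasurableSpace V] (γ : Measure V)
    [IsProbabilityMeasure γ] {Y : V → ℝ} (hY : MemLp Y 2 γ) (h0 : ∫ y, Y y ∂γ = 0) {n : ℕ}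
    (b : Fin n → ℝ) :
    ∫ v, (∑ i, b i * Y (v i)) ^ 2 ∂(Measure.pi fun _ : Fin n => γ) =
      (∑ i, b i ^ 2) * ∫ y, Y y ^ 2 ∂γ := by
  set P : Measure (Fin n → V) := Measure.pi fun _ : Fin n => γ with hP
  have hX : ∀ i : Fin n, MemLp (fun y => b i * Y y) 2 γ := fun i => hY.const_mul (b i)
  have hXi : ∀ i : Fin n, MemLp (fun v : Fin n → V => b i * Y (v i)) 2 P := fun i =>
    (hX i).comp_measurePreserving (measurePreserving_eval (fun _ : Fin n => γ) i)
  have hS : MemLp (fun v : Fin n → V => ∑ i, b i * Y (v i)) 2 P := memLp_sum_mul_pi γ hY b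
  -- the coordinates have the law `γ`
  have hev : ∀ (i : Fin n) (g : V → ℝ), AEStronglyMeasurable g γ →
      ∫ v, g (v i) ∂P = ∫ y, g y ∂γ := by
    intro i g hg
    have hmap := (measurePreserving_eval (fun _ : Fin n => γ) i).map_eq
    rw [← hmap] at hg
    rw [← integral_map (measurable_pi_apply i).aemeasurable hg, hmap]
  -- the sum is centred
  have hmean : ∫ v, ∑ i, b i * Y (v i) ∂P = 0 := by
    rw [integral_finsetSum _ fun i _ => (hXi i).integrable one_le_two]
    refine Finset.sum_eq_zero fun i _ => ?_
    rw [integral_const_mul, hev i Y hY.aestronglyMeasurable, h0, mul_zero]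
  -- its variance
  have hVY : Var[Y; γ] = ∫ y, Y y ^ 2 ∂γ := by
    rw [variance_eq_sub hY, h0]
    simp only [Pi.pow_apply, ne_eq, OfNat.ofNat_ne_zero, not_false_eq_true, zero_pow, sub_zero]
  have hfun : (∑ i, fun v : Fin n → V => b i * Y (v i)) = fun v => ∑ i, b i * Y (v i) := by
    funext v
    simp only [Finset.sum_apply]
  have hvar : Var[fun v : Fin n → V => ∑ i, b i * Y (v i); P] = (∑ i, b i ^ 2) * ∫ y, Y y ^ 2 ∂γ := by
    rw [← hfun, hP, variance_sum_pi (X := fun i y => b i * Y y) hX]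
    simp_rw [variance_const_mul, hVY]
    rw [Finset.sum_mul]
  have h := variance_eq_sub hS
  rw [hmean] at h
  simp only [Pi.pow_apply, ne_eq, OfNat.ofNat_ne_zero, not_false_eq_true, zero_pow, sub_zero] at h
  rw [← h, hvar]

/-! ## From `L²` to probability -/

/-- **Markov**: if `∫⁻ Z_N² dP_N → 0` then `P_N {κ ≤ |Z_N|} → 0` for every `κ > 0`. [folklore] -/
theorem tendsto_measure_le_abs_of_lintegral_sq {Ω : ℕ → Type*} [∀ N, MeasurableSpace (Ω N)]
    (P : (N : ℕ) → Measure (Ω N)) {Z : (N : ℕ) → Ω N → ℝ} (hZ : ∀ N, Measurable (Z N))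
    (h : Tendsto (fun N => ∫⁻ w, ENNReal.ofReal (Z N w ^ 2) ∂P N) atTop (𝓝 0)) {κ : ℝ}
    (hκ : 0 < κ) :
    Tendsto (fun N => P N {w | κ ≤ |Z N w|}) atTop (𝓝 0) := by
  have hk0 : ENNReal.ofReal (κ ^ 2) ≠ 0 := (ENNReal.ofReal_pos.2 (by positivity)).ne'
  have hup : Tendsto (fun N => (∫⁻ w, ENNReal.ofReal (Z N w ^ 2) ∂P N) / ENNReal.ofReal (κ ^ 2))
      atTop (𝓝 0) := by
    have h' := ENNReal.Tendsto.div_const h (Or.inr hk0)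
    rwa [ENNReal.zero_div] at h'
  refine tendsto_of_tendsto_of_tendsto_of_le_of_le tendsto_const_nhds hup (fun N => zero_le)
    fun N => ?_
  calc P N {w | κ ≤ |Z N w|}
      ≤ P N {w | ENNReal.ofReal (κ ^ 2) ≤ ENNReal.ofReal (Z N w ^ 2)} := by
        refine measure_mono fun w hw => ?_
        simp only [mem_setOf_eq] at hw ⊢
        refine ENNReal.ofReal_le_ofReal ?_
        rw [← sq_abs (Z N w)]
        exact pow_le_pow_left₀ hκ.le hw 2
    _ ≤ (∫⁻ w, ENNReal.ofReal (Z N w ^ 2) ∂P N) / ENNReal.ofReal (κ ^ 2) :=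
        meas_ge_le_lintegral_div ((hZ N).pow_const 2).ennreal_ofReal.aemeasurable hk0
          ENNReal.ofReal_ne_top

/-! ## The deterministic continuity estimate -/

/-- **Continuity of `(ρ, m, e) ↦ (ρ, ρ⁻¹ m, θ(ρ, m, e))` at the equilibrium values.**  For every
`ι > 0` there is `κ > 0` such that `|ρ − 1| < κ`, `|mₗ − ρ uₗ| < κ` (`l = 0, 1, 2`) and
`|e − ρ(‖u‖²/2 + 3θ/2)| < κ` imply
`|ρ − 1| + ‖ρ⁻¹ m − u‖ + |(2/3)(e/ρ − ‖m‖²/(2ρ²)) − θ| < ι`. [folklore] -/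
theorem exists_forall_windowFields_lt :
    ∀ (u : V3) (θ ι : ℝ), 0 < ι → ∃ κ : ℝ, 0 < κ ∧ ∀ (ρ e : ℝ) (m : V3), |ρ - 1| < κ →
      (∀ l, |m l - ρ * u l| < κ) → |e - ρ * (‖u‖ ^ 2 / 2 + 3 * θ / 2)| < κ →
      |ρ - 1| + ‖ρ⁻¹ • m - u‖ + |2 / 3 * (e / ρ - ‖m‖ ^ 2 / (2 * ρ ^ 2)) - θ| < ι := by
  intro u θ ι hι
  set c : ℝ := ‖u‖ ^ 2 / 2 + 3 * θ / 2 with hc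
  -- the deviation functional in the variables `(ρ, d, f) = (ρ, m - ρ u, e - ρ c)`
  set Ψ : ℝ × V3 × ℝ → ℝ := fun q =>
    |q.1 - 1| + ‖q.1⁻¹ • (q.2.1 + q.1 • u) - u‖ +
      |2 / 3 * ((q.2.2 + q.1 * c) / q.1 - ‖q.2.1 + q.1 • u‖ ^ 2 / (2 * q.1 ^ 2)) - θ| with hΨ
  have hΨ0 : Ψ (1, 0, 0) = 0 := by
    simp only [hΨ, hc]
    norm_num
  have hcont : ContinuousAt Ψ (1, 0, 0) := by
    simp only [hΨ]
    fun_prop (disch := norm_num)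
  obtain ⟨δ, hδ, hδΨ⟩ := Metric.continuousAt_iff.1 hcont ι hι
  refine ⟨δ / 4, by positivity, fun ρ e m hρ hm he => ?_⟩
  -- the point `(ρ, m - ρ u, e - ρ c)` is `δ`-close to `(1, 0, 0)`
  have hd : ‖m - ρ • u‖ ≤ 3 * (δ / 4) := by
    by_contra hlt
    obtain ⟨l, hl⟩ := exists_lt_abs_apply_of_lt_norm (by positivity) (not_le.1 hlt)
    have h3 : 3 * (δ / 4) / 3 = δ / 4 := by ring
    rw [h3] at hl
    have := hm l
    simp only [PiLp.sub_apply, PiLp.smul_apply, smul_eq_mul] at hl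
    linarith
  have hdist : dist (ρ, m - ρ • u, e - ρ * c) ((1 : ℝ), (0 : V3), (0 : ℝ)) < δ := by
    rw [Prod.dist_eq, Prod.dist_eq, Real.dist_eq, Real.dist_eq, dist_zero_right, sub_zero]
    refine max_lt (by linarith) (max_lt (by linarith) (by linarith [he]))
  have key := hδΨ hdist
  rw [hΨ0, Real.dist_eq, sub_zero] at key
  have hval : Ψ (ρ, m - ρ • u, e - ρ * c) =
      |ρ - 1| + ‖ρ⁻¹ • m - u‖ + |2 / 3 * (e / ρ - ‖m‖ ^ 2 / (2 * ρ ^ 2)) - θ| := by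
    simp only [hΨ, sub_add_cancel]
  rw [hval] at key
  exact lt_of_abs_lt key

/-! ## Two Gaussian facts -/

/-- A continuous `G` with `|G v| ≤ C(1 + ‖v‖²)` is square integrable under `N(u, θ id)`
(Gaussian fourth moments). [folklore] -/
theorem memLp_two_gaussMeasure_of_abs_le {G : V3 → ℝ} (hG : Continuous G) {C : ℝ}
    (hC : ∀ v, |G v| ≤ C * (1 + ‖v‖ ^ 2)) (u : V3) (θ : ℝ) : MemLp G 2 (gaussMeasure u θ) := by
  rw [memLp_two_iff_integrable_sq hG.aestronglyMeasurable]
  have h4 : Integrable (fun v : V3 => ‖v‖ ^ 4) (gaussMeasure u θ) :=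
    (IsGaussian.memLp_id _ 4 (by simp)).integrable_norm_pow (by norm_num)
  have hdom : Integrable (fun v : V3 => 2 * C ^ 2 * (1 + ‖v‖ ^ 4)) (gaussMeasure u θ) :=
    ((integrable_const _).add h4).const_mul _
  refine hdom.mono' (hG.pow 2).aestronglyMeasurable (ae_of_all _ fun v => ?_)
  rw [Real.norm_eq_abs, abs_pow]
  have h1 : |G v| ^ 2 ≤ (C * (1 + ‖v‖ ^ 2)) ^ 2 := pow_le_pow_left₀ (abs_nonneg _) (hC v) 2
  have h2 : (C * (1 + ‖v‖ ^ 2)) ^ 2 ≤ 2 * C ^ 2 * (1 + ‖v‖ ^ 4) := by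
    have h4eq : ‖v‖ ^ 4 = (‖v‖ ^ 2) ^ 2 := by ring
    rw [h4eq]
    nlinarith [mul_nonneg (sq_nonneg C) (sq_nonneg (1 - ‖v‖ ^ 2))]
  exact h1.trans h2

/-- `∫ ‖v‖²/2 dN(u, θ id) = ‖u‖²/2 + 3θ/2` on `ℝ³` (`integral_energy_gaussMeasure`). [folklore] -/
theorem integral_half_norm_sq_gaussMeasure (u : V3) {θ : ℝ} (hθ : 0 < θ) :
    ∫ v, ‖v‖ ^ 2 / 2 ∂gaussMeasure u θ = ‖u‖ ^ 2 / 2 + 3 * θ / 2 := by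
  have h := integral_energy_gaussMeasure u hθ
  have hf : Integrable (fun v : V3 => ‖v‖ ^ 2 / 2) (gaussMeasure u θ) :=
    ((IsGaussian.memLp_id _ 2 (by simp)).integrable_norm_pow (by norm_num)).div_const 2
  have hlin : ∫ v, (‖v‖ ^ 2 / 2 - ‖u‖ ^ 2 / 2 - (Fintype.card (Fin 3) : ℝ) * θ / 2) ∂gaussMeasure u θ =
      ∫ v, ‖v‖ ^ 2 / 2 ∂gaussMeasure u θ - ‖u‖ ^ 2 / 2 - (Fintype.card (Fin 3) : ℝ) * θ / 2 := by
    rw [integral_sub (hf.sub' (integrable_const _)) (integrable_const _),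
      integral_sub hf (integrable_const _), integral_const, integral_const]
    simp only [probReal_univ, one_smul]
  rw [hlin] at h
  simp only [Fintype.card_fin, Nat.cast_ofNat] at h
  linarith

end Summit.AtomisticToContinuum.HydrodynamicLimit.Theorems.EvenStressEnskog

end
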